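import Literature.NumberTheory.Automorphic.ArchKirillovODEGL2Complex
import Literature.NumberTheory.Automorphic.ArchKirillovSignsGL2Real
import Literature.LinearAlgebra.CommonEigenvectorOfCommute
import HarnessLib

/-!
# `K_∞`-finite Gårding vectors of `GL₂(K_∞)` contain joint weight vectors which are highest
# `SU(2)`-weight vectors at the complex places

Topic `NumberTheory/Automorphic`; namespace `Literature.NumberTheory.Automorphic`. Theorems only (no
definition, no named fact, no instance). Step P1c of the archimedean test-vector selection of the
Hecke theory of `GL₂` (Jacquet–Langlands (1970), Thm. 5.15; toward the named fact
`JacquetLanglands1970_twistedHeckeTheoryGL2`). Let `τ` be a strongly continuous representation of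
`G_∞ = GL_n(K_∞)` and `V` a finite-dimensional subspace of its Gårding space stable under
`K_∞ = U(n, K ⊗ ℝ)`.

* `gardingEnd_mem_of_kStable` — `V` is stable under `τ(X)` for every skew-hermitian `X`
  (`X ∈ 𝔨 = 𝔲(n)`): `τ(X) v` is the derivative at `0` of `t ↦ τ(exp tX) v ∈ V` and `V` is closed
  (Harish-Chandra; Borel (1997), 2.16; Knapp (2002), Prop. 1.87; the vector version of the tree's
  `KFiniteLieStable.lieDeriv_mem_of_k_stable`);
* `exists_pow_apply_ne_zero_and_pow_succ_apply_eq_zero` — if `D R = R D + c R` with `c ≠ 0` on a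
  finite-dimensional space and `D x = a x`, `x ≠ 0`, then some `R^j x ≠ 0` has `R^{j+1} x = 0`
  (the `R^j x` are eigenvectors of `D` for the distinct eigenvalues `a + jc`);
* `exists_jointWeightVector_highest` (**main**, `n = 2`) — a non-zero `K_∞`-finite Gårding vector
  `e` yields a non-zero `K_∞`-finite Gårding vector `x` (in the span of the `K_∞`-translates of `e`)
  which is an eigenvector of every `τ(W_w)`, `W_w = (E₀₁ - E₁₀) ⊗ 1_w` (`w` real), of every
  `τ(T_w)`, `T_w = (E₀₀ - E₁₁) ⊗ i_w` (`w` complex), and is killed by every `SU(2)_w`-raising operator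
  `τ((E₀₁ - E₁₀) ⊗ 1_w) - i τ((E₀₁ + E₁₀) ⊗ i_w)` (`w` complex): a common eigenvector of the commuting
  family `{τ(W_w)} ∪ {τ(T_w)}` on `V` (`Literature.LinearAlgebra.exists_ne_zero_forall_apply_eq_smul_of_commute`),
  raised at the complex places as far as possible.

## References

* A. Borel, *Automorphic forms on `SL₂(ℝ)`*, Cambridge Tracts 130 (1997), 2.16. [Borel1997]
* A. W. Knapp, *Lie Groups Beyond an Introduction*, 2nd ed. (2002), Prop. 1.87; *Representation
  Theory of Semisimple Groups* (1986), Ch. VIII §2. [Knapp2002] [Knapp1986]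
* H. Jacquet, R. P. Langlands, *Automorphic Forms on GL(2)*, LNM 114 (1970), §§5–6.
  [JacquetLanglands1970]
-/

noncomputable section

open MeasureTheory Measure NumberField NumberField.InfinitePlace NumberField.mixedEmbedding IsDedekindDomain Set Filter
open scoped MatrixGroups Topology Classical

namespace Literature.NumberTheory.Automorphic

variable {K : Type} [Field K] [NumberField K]

-- as in `ArchGardingWhittaker`
set_option backward.isDefEq.respectTransparency false

/-! ### 1. Finite-dimensional `K_∞`-stable subspaces of the Gårding space are `𝔨`-stable -/

section KStable

variable {n : ℕ} {hcpt : isCompact_glFiniteIntegralLevel n K}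
  {E : Type*} [NormedAddCommGroup E] [NormedSpace ℂ E] [CompleteSpace E]
  {τ : ContRepresentation ℂ (AutomorphyDatum.gl n K hcpt).arch.carrier E}
  (hτ : τ.IsStronglyContinuous)

/-- `exp(tX) ∈ K_∞` for skew-hermitian `X`. [folklore] -/
theorem expGL_smul_mem_Kinf {X : Matrix (Fin n) (Fin n) (mixedSpace K)} (hX : star X = -X) (t : ℝ) :
    expGL (t • X) ∈ Kinf n K := by
  refine ⟨Subgroup.mem_top _, expGL_mem_unitarySubgroupGL ?_⟩
  rw [skewAdjoint.mem_iff, star_smul, hX, smul_neg, star_trivial]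

include hτ in
/-- **A finite-dimensional `K_∞`-stable subspace of the Gårding space is stable under `τ(X)` for
skew-hermitian `X`** (`X ∈ 𝔨 = 𝔲(n)`): `τ(X) v = d/dt τ(exp tX) v |_{t=0}` is a limit of difference
quotients in the closed subspace `V`. (Borel (1997), 2.16; Knapp (2002), Prop. 1.87.)
[cite: Borel1997, 2.16] -/
theorem gardingEnd_mem_of_kStable {V : Submodule ℂ (archGardingSpace hcpt τ)} [FiniteDimensional ℂ V]
    (hK : ∀ κ ∈ Kinf n K, ∀ v ∈ V, gardingAct hτ κ v ∈ V)
    {X : Matrix (Fin n) (Fin n) (mixedSpace K)} (hX : star X = -X) {v : archGardingSpace hcpt τ} (hv : v ∈ V) :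
    gardingEnd hτ X v ∈ V := by
  -- the image of `V` in `E` is finite-dimensional, hence closed
  set S : Submodule ℂ E := V.map (archGardingSpace hcpt τ).subtype with hS
  haveI : FiniteDimensional ℂ S := inferInstance
  have hSc : IsClosed (S : Set E) := Submodule.closed_of_finiteDimensional S
  -- the orbit `t ↦ τ(exp tX) v` lies in `S`
  have horb : ∀ t : ℝ, τ (toArch hcpt (expGL (t • X))) (v : E) ∈ S := fun t =>
    ⟨gardingAct hτ (expGL (t • X)) v, hK _ (expGL_smul_mem_Kinf hX t) v hv, rfl⟩
  -- the derivative at `0` lies in the closed subspace `S`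
  have hder := hasDerivAt_apply_expGL_of_mem_archGardingSpace (hcpt := hcpt) (τ := τ) hτ v.2 X
  rw [hasDerivAt_iff_tendsto_slope] at hder
  have hmem : archDerivE hcpt τ X (v : E) ∈ S := by
    refine hSc.mem_of_tendsto hder ?_
    refine eventually_nhdsWithin_of_forall fun t _ => ?_
    rw [slope_def_module, sub_zero]
    have h0 : τ (toArch hcpt (expGL ((0 : ℝ) • X))) (v : E) = v := by
      rw [zero_smul, expGL_zero]
      change τ 1 (v : E) = v
      rw [map_one]; rfl
    rw [h0, ← Complex.coe_smul]
    exact S.smul_mem _ (S.sub_mem (horb t) (by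
      have h := horb 0
      rwa [h0] at h))
  obtain ⟨u, hu, hu'⟩ := hmem
  have : gardingEnd hτ X v = u := Subtype.ext (by rw [coe_gardingEnd_apply]; exact hu'.symm)
  rw [this]
  exact hu

include hτ in
/-- The span of the `K_∞`-translates of a Gårding vector is `K_∞`-stable. [folklore] -/
theorem gardingAct_mem_span_of_mem (e : archGardingSpace hcpt τ) {κ : GL (Fin n) (mixedSpace K)} (hκ : κ ∈ Kinf n K)
    {v : archGardingSpace hcpt τ}
    (hv : v ∈ Submodule.span ℂ (Set.range fun κ' : Kinf n K => gardingAct hτ (κ' : GL (Fin n) (mixedSpace K)) e)) :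
    gardingAct hτ κ v ∈ Submodule.span ℂ (Set.range fun κ' : Kinf n K => gardingAct hτ (κ' : GL (Fin n) (mixedSpace K)) e) := by
  refine Submodule.span_induction (p := fun v _ => gardingAct hτ κ v ∈
    Submodule.span ℂ (Set.range fun κ' : Kinf n K => gardingAct hτ (κ' : GL (Fin n) (mixedSpace K)) e)) ?_ ?_ ?_ ?_ hv
  · rintro _ ⟨κ', rfl⟩
    refine Submodule.subset_span ⟨⟨κ * κ', mul_mem hκ κ'.2⟩, ?_⟩
    change gardingAct hτ (κ * (κ' : GL (Fin n) (mixedSpace K))) e = gardingAct hτ κ (gardingAct hτ κ' e)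
    rw [gardingAct_mul, Module.End.mul_apply]
  · rw [map_zero]; exact Submodule.zero_mem _
  · intro x y _ _ hx hy
    rw [map_add]; exact Submodule.add_mem _ hx hy
  · intro c x _ hx
    rw [map_smul]; exact Submodule.smul_mem _ c hx

include hτ in
/-- The span of the `K_∞`-translates of a Gårding vector `e` (inside the Gårding space) is
finite-dimensional when the span of the `K_∞`-translates of `e` in `E` is. [folklore] -/
theorem finiteDimensional_span_gardingAct (e : archGardingSpace hcpt τ)
    (hfin : FiniteDimensional ℂ (Submodule.span ℂ (Set.range fun κ : Kinf n K =>
      τ (toArch hcpt (κ : GL (Fin n) (mixedSpace K))) (e : E)))) :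
    FiniteDimensional ℂ (Submodule.span ℂ (Set.range fun κ : Kinf n K => gardingAct hτ (κ : GL (Fin n) (mixedSpace K)) e)) := by
  set W := Submodule.span ℂ (Set.range fun κ : Kinf n K => gardingAct hτ (κ : GL (Fin n) (mixedSpace K)) e)
  have hmap : W.map (archGardingSpace hcpt τ).subtype =
      Submodule.span ℂ (Set.range fun κ : Kinf n K => τ (toArch hcpt (κ : GL (Fin n) (mixedSpace K))) (e : E)) := by
    rw [Submodule.map_span]
    congr 1
    ext x
    simp only [Set.mem_image, Set.mem_range]
    constructor
    · rintro ⟨_, ⟨κ, rfl⟩, rfl⟩; exact ⟨κ, rfl⟩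
    · rintro ⟨κ, rfl⟩; exact ⟨_, ⟨κ, rfl⟩, rfl⟩
  haveI : FiniteDimensional ℂ (W.map (archGardingSpace hcpt τ).subtype) := by rw [hmap]; exact hfin
  exact LinearEquiv.finiteDimensional
    (Submodule.equivMapOfInjective (archGardingSpace hcpt τ).subtype Subtype.val_injective W).symm

include hτ in
/-- Conversely the span in `E` of the `K_∞`-translates of `(x : E)` is finite-dimensional for `x` in a
finite-dimensional `K_∞`-stable subspace of the Gårding space. [folklore] -/
theorem finiteDimensional_span_apply_of_mem {V : Submodule ℂ (archGardingSpace hcpt τ)} [FiniteDimensional ℂ V]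
    (hK : ∀ κ ∈ Kinf n K, ∀ v ∈ V, gardingAct hτ κ v ∈ V) {x : archGardingSpace hcpt τ} (hx : x ∈ V) :
    FiniteDimensional ℂ (Submodule.span ℂ (Set.range fun κ : Kinf n K =>
      τ (toArch hcpt (κ : GL (Fin n) (mixedSpace K))) (x : E))) := by
  refine Submodule.finiteDimensional_of_le (S₂ := V.map (archGardingSpace hcpt τ).subtype) (Submodule.span_le.2 ?_)
  rintro _ ⟨κ, rfl⟩
  exact ⟨gardingAct hτ κ x, hK κ κ.2 x hx, rfl⟩

end KStable

/-! ### 2. Raising strings terminate in finite dimensions -/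

section Raising

variable {V : Type*} [AddCommGroup V] [Module ℂ V] [FiniteDimensional ℂ V]

/-- **Raising strings terminate.** If `D R = R D + c R` (`c ≠ 0`) for endomorphisms of a
finite-dimensional space and `D x = a x` with `x ≠ 0`, then there is `j` with `R^j x ≠ 0` and
`R^{j+1} x = 0`: the `R^j x` are eigenvectors of `D` for the pairwise distinct eigenvalues `a + jc`,
so at most `dim V` of them are non-zero. [folklore] -/
theorem exists_pow_apply_ne_zero_and_pow_succ_apply_eq_zero (D R : Module.End ℂ V) {c : ℂ} (hc : c ≠ 0)
    (hDR : D * R = R * D + c • R) {x : V} (hx : x ≠ 0) {a : ℂ} (ha : D x = a • x) :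
    ∃ j : ℕ, (R ^ j) x ≠ 0 ∧ (R ^ (j + 1)) x = 0 ∧ D ((R ^ j) x) = (a + j * c) • (R ^ j) x := by
  -- the `R^j x` are eigenvectors for `a + jc`
  have heig : ∀ j : ℕ, D ((R ^ j) x) = (a + j * c) • (R ^ j) x := by
    intro j
    induction j with
    | zero => simp [ha]
    | succ j ih =>
      rw [pow_succ', Module.End.mul_apply, ← Module.End.mul_apply (f := D), hDR, LinearMap.add_apply,
        Module.End.mul_apply, ih, map_smul, LinearMap.smul_apply, ← add_smul]
      congr 1
      push_cast
      ring
  -- not all of `x, R x, …, R^N x` (`N = dim V`) are non-zero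
  have hnot : ¬ ∀ j : Fin (Module.finrank ℂ V + 1), (R ^ (j : ℕ)) x ≠ 0 := by
    intro hall
    have hind : LinearIndependent ℂ fun j : Fin (Module.finrank ℂ V + 1) => (R ^ (j : ℕ)) x := by
      refine Module.End.eigenvectors_linearIndependent' D (fun j : Fin (Module.finrank ℂ V + 1) => a + (j : ℕ) * c)
        (fun i j hij => ?_) _ (fun j => ?_)
      · have h : ((i : ℕ) : ℂ) = ((j : ℕ) : ℂ) := mul_right_cancel₀ hc (add_left_cancel hij)
        exact Fin.ext (Nat.cast_injective h)
      · exact Module.End.hasEigenvector_iff.2 ⟨Module.End.mem_eigenspace_iff.2 (heig j), hall j⟩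
    have hcard := hind.fintype_card_le_finrank
    rw [Fintype.card_fin] at hcard
    omega
  push Not at hnot
  -- the first `j` with `R^{j+1} x = 0`
  have hex : ∃ j : ℕ, (R ^ (j + 1)) x = 0 := by
    obtain ⟨j, hj⟩ := hnot
    have hj0 : (j : ℕ) ≠ 0 := by
      intro h0
      rw [h0, pow_zero, Module.End.one_apply] at hj
      exact hx hj
    obtain ⟨k, hk⟩ := Nat.exists_eq_succ_of_ne_zero hj0
    exact ⟨k, by rw [Nat.succ_eq_add_one] at hk; rw [← hk]; exact hj⟩
  refine ⟨Nat.find hex, ?_, Nat.find_spec hex, heig _⟩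
  -- minimality: `R^{j} x ≠ 0` for `j = Nat.find`
  rcases h : Nat.find hex with _ | k
  · rw [pow_zero, Module.End.one_apply]; exact hx
  · exact Nat.find_min hex (by rw [h]; exact Nat.lt_succ_self k)

end Raising

/-! ### 3. The letters of `GL₂(K_∞)` at the places: adjoints and brackets -/

section Letters

omit [NumberField K] in
/-- `star (1_w, 0) = (1_w, 0)` for a real place `w`. [folklore] -/
theorem star_realIdem (w : {w : InfinitePlace K // IsReal w}) :
    star ((Pi.single w 1, 0) : mixedSpace K) = (Pi.single w 1, 0) := by
  rw [Prod.star_def]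
  refine Prod.ext ?_ ?_
  · funext v; simp [Pi.single_apply]
  · simp

omit [NumberField K] in
/-- `star (0, 1_w) = (0, 1_w)` for a complex place `w`. [folklore] -/
theorem star_complexIdem (w : {w : InfinitePlace K // IsComplex w}) :
    star ((0, Pi.single w 1) : mixedSpace K) = (0, Pi.single w 1) := by
  rw [Prod.star_def]
  refine Prod.ext ?_ ?_
  · simp
  · funext v; simp [Pi.single_apply, apply_ite]

omit [NumberField K] in
/-- `star (0, i_w) = -(0, i_w)` for a complex place `w`. [folklore] -/
theorem star_complexIdemI (w : {w : InfinitePlace K // IsComplex w}) :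
    star ((0, Pi.single w Complex.I) : mixedSpace K) = -(0, Pi.single w Complex.I) := by
  rw [Prod.star_def, Prod.neg_mk, neg_zero]
  refine Prod.ext ?_ ?_
  · simp
  · funext v
    simp only [Pi.star_apply, Pi.single_apply, Pi.neg_apply]
    split_ifs <;> simp

omit [NumberField K] in
/-- `single i 0 x * single 1 l y = 0` and `single i 1 x * single 0 l y = 0` in `M₂`. [folklore] -/
theorem single_mul_single_off (x y : mixedSpace K) (i l : Fin 2) :
    Matrix.single i 0 x * Matrix.single 1 l y = 0 ∧ Matrix.single i 1 x * Matrix.single 0 l y = 0 :=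
  ⟨Matrix.single_mul_single_of_ne (h := by decide) (c := x) i 0 1 y,
    Matrix.single_mul_single_of_ne (h := by decide) (c := x) i 1 0 y⟩

omit [NumberField K] in
/-- `single i j x * single k l y = 0` whenever `x y = 0`. [folklore] -/
theorem single_mul_single_eq_zero_of_mul_eq_zero {x y : mixedSpace K} (hxy : x * y = 0) (i j k l : Fin 2) :
    Matrix.single i j x * Matrix.single k l y = 0 := by
  by_cases h : j = k
  · subst h; rw [Matrix.single_mul_single_same, hxy, Matrix.single_zero]
  · exact Matrix.single_mul_single_of_ne (h := h) (c := x) i j k y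

/-- `(0, a_w) (0, b_{w'}) = 0` for distinct complex places — a duplicate of
`inrSingle_mul_inrSingle_of_ne` (`ArchWhittakerGL2Letters`), kept as a deprecated alias. [folklore] -/
@[deprecated inrSingle_mul_inrSingle_of_ne (since := "2026-08-17")]
alias inr_single_mul_inr_single_of_ne := inrSingle_mul_inrSingle_of_ne

end Letters

/-! ### 4. Joint weight vectors, highest at the complex places -/

section Main

variable {hcpt : isCompact_glFiniteIntegralLevel 2 K}
  {E : Type*} [NormedAddCommGroup E] [NormedSpace ℂ E] [CompleteSpace E]
  {τ : ContRepresentation ℂ (AutomorphyDatum.gl 2 K hcpt).arch.carrier E}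
  (hτ : τ.IsStronglyContinuous)

local notation "D" => gardingEnd (hcpt := hcpt) (τ := τ) hτ
local notation "W[" w "]" => (Matrix.single (0 : Fin 2) (1 : Fin 2) ((Pi.single w 1, 0) : mixedSpace K) -
  Matrix.single (1 : Fin 2) (0 : Fin 2) ((Pi.single w 1, 0) : mixedSpace K))
local notation "T[" w "]" => (Matrix.single (0 : Fin 2) (0 : Fin 2) ((0, Pi.single w Complex.I) : mixedSpace K) -
  Matrix.single (1 : Fin 2) (1 : Fin 2) ((0, Pi.single w Complex.I) : mixedSpace K))
local notation "A[" w "]" => (Matrix.single (0 : Fin 2) (1 : Fin 2) ((0, Pi.single w 1) : mixedSpace K) -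
  Matrix.single (1 : Fin 2) (0 : Fin 2) ((0, Pi.single w 1) : mixedSpace K))
local notation "B[" w "]" => (Matrix.single (0 : Fin 2) (1 : Fin 2) ((0, Pi.single w Complex.I) : mixedSpace K) +
  Matrix.single (1 : Fin 2) (0 : Fin 2) ((0, Pi.single w Complex.I) : mixedSpace K))

/-- Two operators `τ(X)`, `τ(Y)` commute when `[X, Y] = 0`. [folklore] -/
theorem gardingEnd_comm_of_bracket_eq_zero {X Y : Matrix (Fin 2) (Fin 2) (mixedSpace K)} (h : X * Y - Y * X = 0) :
    D X * D Y = D Y * D X := by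
  rw [gardingEnd_mul_eq hτ, h, gardingEnd_zero, add_zero]

omit [NumberField K] in
/-- Combinations of `single`s with mutually annihilating coefficients have vanishing products:
if `x y = 0` then `(Σ ± single · · x) (Σ ± single · · y) = 0`, in the four shapes used below. [folklore] -/
theorem letters_mul_eq_zero {x y : mixedSpace K} (hxy : x * y = 0) (i j k l i' j' k' l' : Fin 2) :
    (Matrix.single i j x - Matrix.single k l x) * (Matrix.single i' j' y - Matrix.single k' l' y) = 0 ∧
    (Matrix.single i j x - Matrix.single k l x) * (Matrix.single i' j' y + Matrix.single k' l' y) = 0 ∧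
    (Matrix.single i j x + Matrix.single k l x) * (Matrix.single i' j' y - Matrix.single k' l' y) = 0 ∧
    (Matrix.single i j x + Matrix.single k l x) * (Matrix.single i' j' y + Matrix.single k' l' y) = 0 := by
  have h := single_mul_single_eq_zero_of_mul_eq_zero hxy
  refine ⟨?_, ?_, ?_, ?_⟩ <;> simp only [mul_sub, sub_mul, mul_add, add_mul, h] <;> abel

/-- **The weight operators commute**: `[W_w, W_{w'}] = 0` for real places (`W = (E₀₁ - E₁₀) ⊗ 1_w`;
`W_w W_{w'} = -(E₀₀ + E₁₁) ⊗ 1_w 1_{w'}` is symmetric in `w, w'`). [folklore] -/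
theorem weylR_comm (w w' : {w : InfinitePlace K // IsReal w}) :
    D (Matrix.single 0 1 ((Pi.single w 1, 0) : mixedSpace K) - Matrix.single 1 0 ((Pi.single w 1, 0) : mixedSpace K)) *
      D (Matrix.single 0 1 ((Pi.single w' 1, 0) : mixedSpace K) - Matrix.single 1 0 ((Pi.single w' 1, 0) : mixedSpace K)) =
    D (Matrix.single 0 1 ((Pi.single w' 1, 0) : mixedSpace K) - Matrix.single 1 0 ((Pi.single w' 1, 0) : mixedSpace K)) *
      D (Matrix.single 0 1 ((Pi.single w 1, 0) : mixedSpace K) - Matrix.single 1 0 ((Pi.single w 1, 0) : mixedSpace K)) := by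
  refine gardingEnd_comm_of_bracket_eq_zero hτ ?_
  have hoff := single_mul_single_off (K := K)
  simp only [mul_sub, sub_mul, Matrix.single_mul_single_same, (hoff _ _ _ _).1, (hoff _ _ _ _).2,
    mul_comm ((Pi.single w' 1, 0) : mixedSpace K)]
  abel

/-- `[T_w, T_{w'}] = 0` for complex places (`T = (E₀₀ - E₁₁) ⊗ i_w`, diagonal). [folklore] -/
theorem torusC_comm (w w' : {w : InfinitePlace K // IsComplex w}) :
    D (Matrix.single 0 0 ((0, Pi.single w Complex.I) : mixedSpace K) - Matrix.single 1 1 ((0, Pi.single w Complex.I) : mixedSpace K)) *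
      D (Matrix.single 0 0 ((0, Pi.single w' Complex.I) : mixedSpace K) - Matrix.single 1 1 ((0, Pi.single w' Complex.I) : mixedSpace K)) =
    D (Matrix.single 0 0 ((0, Pi.single w' Complex.I) : mixedSpace K) - Matrix.single 1 1 ((0, Pi.single w' Complex.I) : mixedSpace K)) *
      D (Matrix.single 0 0 ((0, Pi.single w Complex.I) : mixedSpace K) - Matrix.single 1 1 ((0, Pi.single w Complex.I) : mixedSpace K)) := by
  refine gardingEnd_comm_of_bracket_eq_zero hτ ?_
  have hoff := single_mul_single_off (K := K)
  simp only [mul_sub, sub_mul, Matrix.single_mul_single_same, (hoff _ _ _ _).1, (hoff _ _ _ _).2,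
    mul_comm ((0, Pi.single w' Complex.I) : mixedSpace K)]
  abel

/-- `[W_w, T_{w'}] = 0` for `w` real and `w'` complex (`1_w i_{w'} = 0`). [folklore] -/
theorem weylR_comm_torusC (w : {w : InfinitePlace K // IsReal w}) (w' : {w : InfinitePlace K // IsComplex w}) :
    D (Matrix.single 0 1 ((Pi.single w 1, 0) : mixedSpace K) - Matrix.single 1 0 ((Pi.single w 1, 0) : mixedSpace K)) *
      D (Matrix.single 0 0 ((0, Pi.single w' Complex.I) : mixedSpace K) - Matrix.single 1 1 ((0, Pi.single w' Complex.I) : mixedSpace K)) =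
    D (Matrix.single 0 0 ((0, Pi.single w' Complex.I) : mixedSpace K) - Matrix.single 1 1 ((0, Pi.single w' Complex.I) : mixedSpace K)) *
      D (Matrix.single 0 1 ((Pi.single w 1, 0) : mixedSpace K) - Matrix.single 1 0 ((Pi.single w 1, 0) : mixedSpace K)) := by
  refine gardingEnd_comm_of_bracket_eq_zero hτ ?_
  have hxy : ((Pi.single w 1, 0) : mixedSpace K) * (0, Pi.single w' Complex.I) = 0 := realIdem_mul_inr w _
  have hyx : ((0, Pi.single w' Complex.I) : mixedSpace K) * (Pi.single w 1, 0) = 0 := by rw [mul_comm]; exact hxy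
  rw [(letters_mul_eq_zero hxy 0 1 1 0 0 0 1 1).1, (letters_mul_eq_zero hyx 0 0 1 1 0 1 1 0).1, sub_zero]

/-- **`[τ(T_w), R_w] = 2i R_w`** for the `SU(2)_w`-raising operator
`R_w = τ((E₀₁ - E₁₀) ⊗ 1_w) - i τ((E₀₁ + E₁₀) ⊗ i_w)` (`[T, A] = 2B`, `[T, B] = -2A` for
`A = (E₀₁ - E₁₀) ⊗ 1_w`, `B = (E₀₁ + E₁₀) ⊗ i_w`). [folklore] -/
theorem torusC_mul_raising (w : {w : InfinitePlace K // IsComplex w}) :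
    D (Matrix.single 0 0 ((0, Pi.single w Complex.I) : mixedSpace K) - Matrix.single 1 1 ((0, Pi.single w Complex.I) : mixedSpace K)) *
      (D (Matrix.single 0 1 ((0, Pi.single w 1) : mixedSpace K) - Matrix.single 1 0 ((0, Pi.single w 1) : mixedSpace K)) -
        Complex.I • D (Matrix.single 0 1 ((0, Pi.single w Complex.I) : mixedSpace K) + Matrix.single 1 0 ((0, Pi.single w Complex.I) : mixedSpace K))) =
    (D (Matrix.single 0 1 ((0, Pi.single w 1) : mixedSpace K) - Matrix.single 1 0 ((0, Pi.single w 1) : mixedSpace K)) -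
        Complex.I • D (Matrix.single 0 1 ((0, Pi.single w Complex.I) : mixedSpace K) + Matrix.single 1 0 ((0, Pi.single w Complex.I) : mixedSpace K))) *
      D (Matrix.single 0 0 ((0, Pi.single w Complex.I) : mixedSpace K) - Matrix.single 1 1 ((0, Pi.single w Complex.I) : mixedSpace K)) +
    (2 * Complex.I) • (D (Matrix.single 0 1 ((0, Pi.single w 1) : mixedSpace K) - Matrix.single 1 0 ((0, Pi.single w 1) : mixedSpace K)) -
        Complex.I • D (Matrix.single 0 1 ((0, Pi.single w Complex.I) : mixedSpace K) + Matrix.single 1 0 ((0, Pi.single w Complex.I) : mixedSpace K))) := by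
  have hoff := single_mul_single_off (K := K)
  have hcc := complexIdem_mul_complexIdemI (K := K) w
  have hcc' := complexIdemI_mul_complexIdem (K := K) w
  have hii := complexIdemI_mul_self (K := K) w
  -- the matrix brackets
  have hTA : ((Matrix.single 0 0 ((0, Pi.single w Complex.I) : mixedSpace K) - Matrix.single 1 1 ((0, Pi.single w Complex.I) : mixedSpace K)) *
        (Matrix.single 0 1 ((0, Pi.single w 1) : mixedSpace K) - Matrix.single 1 0 ((0, Pi.single w 1) : mixedSpace K)) -
      (Matrix.single 0 1 ((0, Pi.single w 1) : mixedSpace K) - Matrix.single 1 0 ((0, Pi.single w 1) : mixedSpace K)) *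
        (Matrix.single 0 0 ((0, Pi.single w Complex.I) : mixedSpace K) - Matrix.single 1 1 ((0, Pi.single w Complex.I) : mixedSpace K)) :
        Matrix (Fin 2) (Fin 2) (mixedSpace K)) =
      (2 : ℝ) • (Matrix.single 0 1 ((0, Pi.single w Complex.I) : mixedSpace K) + Matrix.single 1 0 ((0, Pi.single w Complex.I) : mixedSpace K)) := by
    simp only [mul_sub, sub_mul, Matrix.single_mul_single_same, (hoff _ _ _ _).1, (hoff _ _ _ _).2, hcc, hcc', two_smul]
    abel
  have hTB : ((Matrix.single 0 0 ((0, Pi.single w Complex.I) : mixedSpace K) - Matrix.single 1 1 ((0, Pi.single w Complex.I) : mixedSpace K)) *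
        (Matrix.single 0 1 ((0, Pi.single w Complex.I) : mixedSpace K) + Matrix.single 1 0 ((0, Pi.single w Complex.I) : mixedSpace K)) -
      (Matrix.single 0 1 ((0, Pi.single w Complex.I) : mixedSpace K) + Matrix.single 1 0 ((0, Pi.single w Complex.I) : mixedSpace K)) *
        (Matrix.single 0 0 ((0, Pi.single w Complex.I) : mixedSpace K) - Matrix.single 1 1 ((0, Pi.single w Complex.I) : mixedSpace K)) :
        Matrix (Fin 2) (Fin 2) (mixedSpace K)) =
      (-2 : ℝ) • (Matrix.single 0 1 ((0, Pi.single w 1) : mixedSpace K) - Matrix.single 1 0 ((0, Pi.single w 1) : mixedSpace K)) := by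
    simp only [mul_sub, sub_mul, mul_add, add_mul, Matrix.single_mul_single_same, (hoff _ _ _ _).1, (hoff _ _ _ _).2, hii,
      neg_smul, two_smul, ← Matrix.single_neg]
    abel
  have h1 := gardingEnd_mul_eq (hcpt := hcpt) (τ := τ) hτ
    (Matrix.single 0 0 ((0, Pi.single w Complex.I) : mixedSpace K) - Matrix.single 1 1 ((0, Pi.single w Complex.I) : mixedSpace K))
    (Matrix.single 0 1 ((0, Pi.single w 1) : mixedSpace K) - Matrix.single 1 0 ((0, Pi.single w 1) : mixedSpace K))
  have h2 := gardingEnd_mul_eq (hcpt := hcpt) (τ := τ) hτ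
    (Matrix.single 0 0 ((0, Pi.single w Complex.I) : mixedSpace K) - Matrix.single 1 1 ((0, Pi.single w Complex.I) : mixedSpace K))
    (Matrix.single 0 1 ((0, Pi.single w Complex.I) : mixedSpace K) + Matrix.single 1 0 ((0, Pi.single w Complex.I) : mixedSpace K))
  rw [hTA, gardingEnd_smul] at h1
  rw [hTB, gardingEnd_smul] at h2
  -- treat the three operators as atoms
  set T := D (Matrix.single 0 0 ((0, Pi.single w Complex.I) : mixedSpace K) - Matrix.single 1 1 ((0, Pi.single w Complex.I) : mixedSpace K))
  set A := D (Matrix.single 0 1 ((0, Pi.single w 1) : mixedSpace K) - Matrix.single 1 0 ((0, Pi.single w 1) : mixedSpace K))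
  set B := D (Matrix.single 0 1 ((0, Pi.single w Complex.I) : mixedSpace K) + Matrix.single 1 0 ((0, Pi.single w Complex.I) : mixedSpace K))
  rw [mul_sub, mul_smul_comm, h1, h2, sub_mul, smul_mul_assoc]
  have hI2 : Complex.I * (((-2 : ℝ) : ℂ)) = -(2 * Complex.I) := by push_cast; ring
  have hI3 : 2 * Complex.I * Complex.I = -(((2 : ℝ) : ℂ)) := by
    rw [mul_assoc, Complex.I_mul_I]; push_cast; ring
  simp only [smul_add, smul_sub, smul_smul, hI2, hI3, neg_smul]
  abel

/-- `R_w` commutes with the weight operators at the OTHER places and with `R_{w'}`, `w' ≠ w`. [folklore] -/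
theorem raising_comm (w : {w : InfinitePlace K // IsComplex w}) :
    (∀ w' : {w : InfinitePlace K // IsReal w},
      (D (Matrix.single 0 1 ((0, Pi.single w 1) : mixedSpace K) - Matrix.single 1 0 ((0, Pi.single w 1) : mixedSpace K)) -
        Complex.I • D (Matrix.single 0 1 ((0, Pi.single w Complex.I) : mixedSpace K) + Matrix.single 1 0 ((0, Pi.single w Complex.I) : mixedSpace K))) *
        D (Matrix.single 0 1 ((Pi.single w' 1, 0) : mixedSpace K) - Matrix.single 1 0 ((Pi.single w' 1, 0) : mixedSpace K)) =
      D (Matrix.single 0 1 ((Pi.single w' 1, 0) : mixedSpace K) - Matrix.single 1 0 ((Pi.single w' 1, 0) : mixedSpace K)) *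
        (D (Matrix.single 0 1 ((0, Pi.single w 1) : mixedSpace K) - Matrix.single 1 0 ((0, Pi.single w 1) : mixedSpace K)) -
          Complex.I • D (Matrix.single 0 1 ((0, Pi.single w Complex.I) : mixedSpace K) + Matrix.single 1 0 ((0, Pi.single w Complex.I) : mixedSpace K)))) ∧
    (∀ w' : {w : InfinitePlace K // IsComplex w}, w' ≠ w →
      (D (Matrix.single 0 1 ((0, Pi.single w 1) : mixedSpace K) - Matrix.single 1 0 ((0, Pi.single w 1) : mixedSpace K)) -
        Complex.I • D (Matrix.single 0 1 ((0, Pi.single w Complex.I) : mixedSpace K) + Matrix.single 1 0 ((0, Pi.single w Complex.I) : mixedSpace K))) *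
        D (Matrix.single 0 0 ((0, Pi.single w' Complex.I) : mixedSpace K) - Matrix.single 1 1 ((0, Pi.single w' Complex.I) : mixedSpace K)) =
      D (Matrix.single 0 0 ((0, Pi.single w' Complex.I) : mixedSpace K) - Matrix.single 1 1 ((0, Pi.single w' Complex.I) : mixedSpace K)) *
        (D (Matrix.single 0 1 ((0, Pi.single w 1) : mixedSpace K) - Matrix.single 1 0 ((0, Pi.single w 1) : mixedSpace K)) -
          Complex.I • D (Matrix.single 0 1 ((0, Pi.single w Complex.I) : mixedSpace K) + Matrix.single 1 0 ((0, Pi.single w Complex.I) : mixedSpace K)))) ∧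
    (∀ w' : {w : InfinitePlace K // IsComplex w}, w' ≠ w →
      (D (Matrix.single 0 1 ((0, Pi.single w 1) : mixedSpace K) - Matrix.single 1 0 ((0, Pi.single w 1) : mixedSpace K)) -
        Complex.I • D (Matrix.single 0 1 ((0, Pi.single w Complex.I) : mixedSpace K) + Matrix.single 1 0 ((0, Pi.single w Complex.I) : mixedSpace K))) *
        (D (Matrix.single 0 1 ((0, Pi.single w' 1) : mixedSpace K) - Matrix.single 1 0 ((0, Pi.single w' 1) : mixedSpace K)) -
          Complex.I • D (Matrix.single 0 1 ((0, Pi.single w' Complex.I) : mixedSpace K) + Matrix.single 1 0 ((0, Pi.single w' Complex.I) : mixedSpace K))) =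
      (D (Matrix.single 0 1 ((0, Pi.single w' 1) : mixedSpace K) - Matrix.single 1 0 ((0, Pi.single w' 1) : mixedSpace K)) -
          Complex.I • D (Matrix.single 0 1 ((0, Pi.single w' Complex.I) : mixedSpace K) + Matrix.single 1 0 ((0, Pi.single w' Complex.I) : mixedSpace K))) *
        (D (Matrix.single 0 1 ((0, Pi.single w 1) : mixedSpace K) - Matrix.single 1 0 ((0, Pi.single w 1) : mixedSpace K)) -
          Complex.I • D (Matrix.single 0 1 ((0, Pi.single w Complex.I) : mixedSpace K) + Matrix.single 1 0 ((0, Pi.single w Complex.I) : mixedSpace K)))) := by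
  -- generic: if `X Y = 0 = Y X` pairwise then the four operators commute
  have key : ∀ {X₁ X₂ Y : Matrix (Fin 2) (Fin 2) (mixedSpace K)}, X₁ * Y = 0 → Y * X₁ = 0 → X₂ * Y = 0 → Y * X₂ = 0 →
      (D X₁ - Complex.I • D X₂) * D Y = D Y * (D X₁ - Complex.I • D X₂) := by
    intro X₁ X₂ Y h1 h1' h2 h2'
    have c1 : D X₁ * D Y = D Y * D X₁ := gardingEnd_comm_of_bracket_eq_zero hτ (by rw [h1, h1', sub_zero])
    have c2 : D X₂ * D Y = D Y * D X₂ := gardingEnd_comm_of_bracket_eq_zero hτ (by rw [h2, h2', sub_zero])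
    rw [sub_mul, mul_sub, smul_mul_assoc, mul_smul_comm, c1, c2]
  refine ⟨fun w' => ?_, fun w' hw' => ?_, fun w' hw' => ?_⟩
  · have hxy : ((0, Pi.single w 1) : mixedSpace K) * (Pi.single w' 1, 0) = 0 := by rw [mul_comm]; exact realIdem_mul_inr w' _
    have hyx : ((Pi.single w' 1, 0) : mixedSpace K) * (0, Pi.single w 1) = 0 := realIdem_mul_inr w' _
    have hxy' : ((0, Pi.single w Complex.I) : mixedSpace K) * (Pi.single w' 1, 0) = 0 := by rw [mul_comm]; exact realIdem_mul_inr w' _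
    have hyx' : ((Pi.single w' 1, 0) : mixedSpace K) * (0, Pi.single w Complex.I) = 0 := realIdem_mul_inr w' _
    exact key (letters_mul_eq_zero hxy 0 1 1 0 0 1 1 0).1 (letters_mul_eq_zero hyx 0 1 1 0 0 1 1 0).1
      (letters_mul_eq_zero hxy' 0 1 1 0 0 1 1 0).2.2.1 (letters_mul_eq_zero hyx' 0 1 1 0 0 1 1 0).2.1
  · have hxy : ((0, Pi.single w 1) : mixedSpace K) * (0, Pi.single w' Complex.I) = 0 := inrSingle_mul_inrSingle_of_ne (Ne.symm hw') _ _
    have hyx : ((0, Pi.single w' Complex.I) : mixedSpace K) * (0, Pi.single w 1) = 0 := inrSingle_mul_inrSingle_of_ne hw' _ _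
    have hxy' : ((0, Pi.single w Complex.I) : mixedSpace K) * (0, Pi.single w' Complex.I) = 0 := inrSingle_mul_inrSingle_of_ne (Ne.symm hw') _ _
    have hyx' : ((0, Pi.single w' Complex.I) : mixedSpace K) * (0, Pi.single w Complex.I) = 0 := inrSingle_mul_inrSingle_of_ne hw' _ _
    exact key (letters_mul_eq_zero hxy 0 1 1 0 0 0 1 1).1 (letters_mul_eq_zero hyx 0 0 1 1 0 1 1 0).1
      (letters_mul_eq_zero hxy' 0 1 1 0 0 0 1 1).2.2.1 (letters_mul_eq_zero hyx' 0 0 1 1 0 1 1 0).2.1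
  · have hxy : ((0, Pi.single w 1) : mixedSpace K) * (0, Pi.single w' 1) = 0 := inrSingle_mul_inrSingle_of_ne (Ne.symm hw') _ _
    have hyx : ((0, Pi.single w' 1) : mixedSpace K) * (0, Pi.single w 1) = 0 := inrSingle_mul_inrSingle_of_ne hw' _ _
    have hxyI : ((0, Pi.single w 1) : mixedSpace K) * (0, Pi.single w' Complex.I) = 0 := inrSingle_mul_inrSingle_of_ne (Ne.symm hw') _ _
    have hyxI : ((0, Pi.single w' Complex.I) : mixedSpace K) * (0, Pi.single w 1) = 0 := inrSingle_mul_inrSingle_of_ne hw' _ _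
    have hIxy : ((0, Pi.single w Complex.I) : mixedSpace K) * (0, Pi.single w' 1) = 0 := inrSingle_mul_inrSingle_of_ne (Ne.symm hw') _ _
    have hIyx : ((0, Pi.single w' 1) : mixedSpace K) * (0, Pi.single w Complex.I) = 0 := inrSingle_mul_inrSingle_of_ne hw' _ _
    have hII : ((0, Pi.single w Complex.I) : mixedSpace K) * (0, Pi.single w' Complex.I) = 0 := inrSingle_mul_inrSingle_of_ne (Ne.symm hw') _ _
    have hII' : ((0, Pi.single w' Complex.I) : mixedSpace K) * (0, Pi.single w Complex.I) = 0 := inrSingle_mul_inrSingle_of_ne hw' _ _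
    have cA := key (letters_mul_eq_zero hxy 0 1 1 0 0 1 1 0).1 (letters_mul_eq_zero hyx 0 1 1 0 0 1 1 0).1
      (letters_mul_eq_zero hIxy 0 1 1 0 0 1 1 0).2.2.1 (letters_mul_eq_zero hIyx 0 1 1 0 0 1 1 0).2.1
    have cB := key (letters_mul_eq_zero hxyI 0 1 1 0 0 1 1 0).2.1 (letters_mul_eq_zero hyxI 0 1 1 0 0 1 1 0).2.2.1
      (letters_mul_eq_zero hII 0 1 1 0 0 1 1 0).2.2.2 (letters_mul_eq_zero hII' 0 1 1 0 0 1 1 0).2.2.2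
    rw [mul_sub, mul_smul_comm, cA, cB, sub_mul, smul_mul_assoc]


omit [NumberField K] in
/-- The letters `W_w`, `T_w`, `(E₀₁ - E₁₀) ⊗ 1_w`, `(E₀₁ + E₁₀) ⊗ i_w` are skew-hermitian. [folklore] -/
theorem star_letters :
    (∀ w : {w : InfinitePlace K // IsReal w}, star W[w] = -W[w]) ∧
    (∀ w : {w : InfinitePlace K // IsComplex w}, star T[w] = -T[w]) ∧
    (∀ w : {w : InfinitePlace K // IsComplex w}, star A[w] = -A[w]) ∧
    (∀ w : {w : InfinitePlace K // IsComplex w}, star B[w] = -B[w]) := by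
  refine ⟨fun w => ?_, fun w => ?_, fun w => ?_, fun w => ?_⟩
  · rw [star_sub, Matrix.star_eq_conjTranspose, Matrix.star_eq_conjTranspose, Matrix.conjTranspose_single,
      Matrix.conjTranspose_single, star_realIdem, neg_sub]
  · rw [star_sub, Matrix.star_eq_conjTranspose, Matrix.star_eq_conjTranspose, Matrix.conjTranspose_single,
      Matrix.conjTranspose_single, star_complexIdemI, ← Matrix.single_neg, ← Matrix.single_neg, neg_sub, sub_neg_eq_add]
    abel
  · rw [star_sub, Matrix.star_eq_conjTranspose, Matrix.star_eq_conjTranspose, Matrix.conjTranspose_single,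
      Matrix.conjTranspose_single, star_complexIdem, neg_sub]
  · rw [star_add, Matrix.star_eq_conjTranspose, Matrix.star_eq_conjTranspose, Matrix.conjTranspose_single,
      Matrix.conjTranspose_single, star_complexIdemI, ← Matrix.single_neg, ← Matrix.single_neg, neg_add]
    abel

/-- **Joint weight vectors, highest at the complex places.** A non-zero `K_∞`-finite Gårding vector
`e` of a strongly continuous representation of `GL₂(K_∞)` yields a non-zero Gårding vector `x` in the
span of the `K_∞`-translates of `e` (so again `K_∞`-finite) which is an eigenvector of every
`τ((E₀₁ - E₁₀) ⊗ 1_w)` (`w` real) and every `τ((E₀₀ - E₁₁) ⊗ i_w)` (`w` complex) and is killed by every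
`SU(2)_w`-raising operator `τ((E₀₁ - E₁₀) ⊗ 1_w) - i τ((E₀₁ + E₁₀) ⊗ i_w)` (`w` complex).
(Jacquet–Langlands (1970), §5 (Lemma 5.6 ff.) and §6: the `K_∞`-types of an irreducible representation
and their weight vectors.) [cite: JacquetLanglands1970, §5–§6] -/
theorem exists_jointWeightVector_highest {e : archGardingSpace hcpt τ} (he : e ≠ 0)
    (hfin : FiniteDimensional ℂ (Submodule.span ℂ (Set.range fun κ : (AutomorphyDatum.gl 2 K hcpt).arch.maximalCompact =>
      τ (toArch hcpt (κ : GL (Fin 2) (mixedSpace K))) (e : E)))) :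
    ∃ x : archGardingSpace hcpt τ, x ≠ 0 ∧
      x ∈ Submodule.span ℂ (Set.range fun κ : Kinf 2 K => gardingAct hτ (κ : GL (Fin 2) (mixedSpace K)) e) ∧
      FiniteDimensional ℂ (Submodule.span ℂ (Set.range fun κ : (AutomorphyDatum.gl 2 K hcpt).arch.maximalCompact =>
        τ (toArch hcpt (κ : GL (Fin 2) (mixedSpace K))) (x : E))) ∧
      (∀ w : {w : InfinitePlace K // IsReal w}, ∃ k : ℂ, D W[w] x = k • x) ∧
      (∀ w : {w : InfinitePlace K // IsComplex w}, ∃ m : ℂ, D T[w] x = m • x) ∧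
      (∀ w : {w : InfinitePlace K // IsComplex w}, D A[w] x - Complex.I • D B[w] x = 0) := by
  obtain ⟨sW, sT, sA, sB⟩ := star_letters (K := K)
  -- the finite-dimensional `K_∞`-stable space `V`
  set V : Submodule ℂ (archGardingSpace hcpt τ) :=
    Submodule.span ℂ (Set.range fun κ : Kinf 2 K => gardingAct hτ (κ : GL (Fin 2) (mixedSpace K)) e) with hVdef
  haveI hVfd : FiniteDimensional ℂ V := finiteDimensional_span_gardingAct hτ e hfin
  have hK : ∀ κ ∈ Kinf 2 K, ∀ v ∈ V, gardingAct hτ κ v ∈ V := fun κ hκ v hv => gardingAct_mem_span_of_mem hτ e hκ hv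
  have heV : e ∈ V := Submodule.subset_span ⟨⟨1, one_mem _⟩, by
    change gardingAct hτ (1 : GL (Fin 2) (mixedSpace K)) e = e
    rw [gardingAct_one]; rfl⟩
  haveI : Nontrivial V := ⟨⟨⟨e, heV⟩, 0, fun h => he (congrArg Subtype.val h)⟩⟩
  -- the letters preserve `V`
  have hWV : ∀ w : {w : InfinitePlace K // IsReal w}, ∀ v ∈ V, D W[w] v ∈ V :=
    fun w v hv => gardingEnd_mem_of_kStable hτ hK (sW w) hv
  have hTV : ∀ w : {w : InfinitePlace K // IsComplex w}, ∀ v ∈ V, D T[w] v ∈ V :=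
    fun w v hv => gardingEnd_mem_of_kStable hτ hK (sT w) hv
  have hRV : ∀ w : {w : InfinitePlace K // IsComplex w}, ∀ v ∈ V, (D A[w] - Complex.I • D B[w]) v ∈ V := fun w v hv => by
    rw [LinearMap.sub_apply, LinearMap.smul_apply]
    exact V.sub_mem (gardingEnd_mem_of_kStable hτ hK (sA w) hv) (V.smul_mem _ (gardingEnd_mem_of_kStable hτ hK (sB w) hv))
  -- the torus family `F` and the raising operators `Rv` on `V`
  obtain ⟨F, hF₁, hF₂⟩ : ∃ F : ({w : InfinitePlace K // IsReal w} ⊕ {w : InfinitePlace K // IsComplex w}) → Module.End ℂ V,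
      (∀ w, F (Sum.inl w) = (D W[w]).restrict (hWV w)) ∧ ∀ w, F (Sum.inr w) = (D T[w]).restrict (hTV w) :=
    ⟨fun i => Sum.elim (fun w => (D W[w]).restrict (hWV w)) (fun w => (D T[w]).restrict (hTV w)) i, fun w => rfl, fun w => rfl⟩
  obtain ⟨Rv, hRv⟩ : ∃ Rv : {w : InfinitePlace K // IsComplex w} → Module.End ℂ V,
      ∀ w, Rv w = (D A[w] - Complex.I • D B[w]).restrict (hRV w) := ⟨_, fun w => rfl⟩
  -- commutation relations on `V`
  have hFcomm : ∀ i j, Commute (F i) (F j) := by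
    rintro (w | w) (w' | w')
    · rw [hF₁, hF₁]; exact LinearMap.restrict_commute (weylR_comm hτ w w') _ _
    · rw [hF₁, hF₂]; exact LinearMap.restrict_commute (weylR_comm_torusC hτ w w') _ _
    · rw [hF₂, hF₁]; exact LinearMap.restrict_commute (weylR_comm_torusC hτ w' w).symm _ _
    · rw [hF₂, hF₂]; exact LinearMap.restrict_commute (torusC_comm hτ w w') _ _
  have hRF : ∀ w i, i ≠ Sum.inr w → Commute (Rv w) (F i) := by
    rintro w (w' | w') hi
    · rw [hRv, hF₁]; exact LinearMap.restrict_commute ((raising_comm hτ w).1 w') _ _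
    · rw [hRv, hF₂]; exact LinearMap.restrict_commute ((raising_comm hτ w).2.1 w' (fun h => hi (by rw [h]))) _ _
  have hRRv : ∀ w w', w' ≠ w → Commute (Rv w) (Rv w') := fun w w' h => by
    rw [hRv, hRv]; exact LinearMap.restrict_commute ((raising_comm hτ w).2.2 w' h) _ _
  have hTR : ∀ w, F (Sum.inr w) * Rv w = Rv w * F (Sum.inr w) + (2 * Complex.I) • Rv w := by
    intro w
    rw [hF₂, hRv]
    refine LinearMap.ext fun v => Subtype.ext ?_
    have h := congrArg (fun T => T (v : archGardingSpace hcpt τ)) (torusC_mul_raising hτ w)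
    simpa only [Module.End.mul_apply, LinearMap.add_apply, LinearMap.smul_apply, LinearMap.coe_restrict_apply,
      Submodule.coe_add, Submodule.coe_smul] using h
  -- a common eigenvector of the torus family
  obtain ⟨x₀, hx₀, hx₀eig⟩ := Literature.LinearAlgebra.exists_ne_zero_forall_apply_eq_smul_of_commute F hFcomm
  -- minimise the number of complex places at which the vector is not highest
  let bad : V → ℕ := fun y => (Finset.univ.filter fun w => Rv w y ≠ 0).card
  have hex : ∃ m : ℕ, ∃ y : V, (y ≠ 0 ∧ ∀ i, ∃ a : ℂ, F i y = a • y) ∧ bad y = m := ⟨_, x₀, ⟨hx₀, hx₀eig⟩, rfl⟩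
  obtain ⟨y, ⟨hy0, hyeig⟩, hym⟩ := Nat.find_spec hex
  have hbad : ∀ w, Rv w y = 0 := by
    by_contra hne
    push Not at hne
    obtain ⟨w, hw⟩ := hne
    obtain ⟨a, ha⟩ := hyeig (Sum.inr w)
    obtain ⟨j, hj0, hj1, hjeig⟩ := exists_pow_apply_ne_zero_and_pow_succ_apply_eq_zero (F (Sum.inr w)) (Rv w)
      (mul_ne_zero two_ne_zero Complex.I_ne_zero) (hTR w) hy0 ha
    -- `y' = R^j y` is again a joint eigenvector
    have hy'eig : ∀ i, ∃ a : ℂ, F i ((Rv w ^ j) y) = a • (Rv w ^ j) y := by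
      intro i
      by_cases hi : i = Sum.inr w
      · subst hi; exact ⟨_, hjeig⟩
      · obtain ⟨b, hb⟩ := hyeig i
        refine ⟨b, ?_⟩
        rw [← Module.End.mul_apply, ← ((hRF w i hi).pow_left j).eq, Module.End.mul_apply, hb, map_smul]
    -- and is highest at strictly fewer places
    have hlt : bad ((Rv w ^ j) y) < bad y := by
      have hsub : (Finset.univ.filter fun w' => Rv w' ((Rv w ^ j) y) ≠ 0) ⊆
          (Finset.univ.filter fun w' => Rv w' y ≠ 0).erase w := by
        intro w' hw'
        rw [Finset.mem_filter] at hw'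
        rw [Finset.mem_erase, Finset.mem_filter]
        have hne' : w' ≠ w := by
          rintro rfl
          apply hw'.2
          rw [← Module.End.mul_apply, ← pow_succ']
          exact hj1
        refine ⟨hne', Finset.mem_univ _, fun h0 => hw'.2 ?_⟩
        rw [← Module.End.mul_apply, ((hRRv w' w hne'.symm).pow_right j).eq, Module.End.mul_apply, h0, map_zero]
      calc bad ((Rv w ^ j) y) ≤ ((Finset.univ.filter fun w' => Rv w' y ≠ 0).erase w).card := Finset.card_le_card hsub
        _ < bad y := Finset.card_erase_lt_of_mem (by rw [Finset.mem_filter]; exact ⟨Finset.mem_univ _, hw⟩)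
    have hmin := Nat.find_min' hex ⟨(Rv w ^ j) y, ⟨hj0, hy'eig⟩, rfl⟩
    rw [hym] at hlt
    exact absurd hmin (not_le.2 hlt)
  -- read off the statement on `x = y`
  refine ⟨(y : archGardingSpace hcpt τ), fun h => hy0 (Subtype.ext h), y.2, finiteDimensional_span_apply_of_mem hτ hK y.2,
    fun w => ?_, fun w => ?_, fun w => ?_⟩
  · obtain ⟨a, ha⟩ := hyeig (Sum.inl w)
    rw [hF₁] at ha
    exact ⟨a, by simpa only [LinearMap.coe_restrict_apply, Submodule.coe_smul] using congrArg Subtype.val ha⟩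
  · obtain ⟨a, ha⟩ := hyeig (Sum.inr w)
    rw [hF₂] at ha
    exact ⟨a, by simpa only [LinearMap.coe_restrict_apply, Submodule.coe_smul] using congrArg Subtype.val ha⟩
  · have h := hbad w
    rw [hRv] at h
    have h' := congrArg Subtype.val h
    simpa only [LinearMap.coe_restrict_apply, LinearMap.sub_apply, LinearMap.smul_apply, Submodule.coe_zero] using h'

end Main


end Literature.NumberTheory.Automorphic
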